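import Summits.Ventures.QEDPrecision.Diagrams.VolkovOnShellSetsOrder10C131Closes

/-!
Venture QEDPrecision / cell `pub-qed`, unit `pub-qed-int-2` (INT-2, gen 9). HONEST FRAMING: independent recomputation; certified
where stated, statistical where stated; no new-physics claim.  NEW WORK of the cell (a kernel-checked formal identity in the
unit's OWN model), not a published result: nothing here is cited as a fact anywhere; the printed sources are named only in
comments.
Staged copy: HOME/lean/int2/VolkovOnShellSetsOrder10C131ClosesFinal.lean (declarations byte-identical).

# Five loops: the class (1;3,1) closes — final part (groups 1–4 and the closure)

Finishes the chain of `VolkovOnShellSetsOrder10C131Closes`: suffix sums for groups 1–4 and `class131_closes` — `closes 5 rows131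
perm131 = true`: in the unit's formal Ward-identity model the class (1;3,1) (its 148 rows, visited group by group;
`perm131_perm`: a permutation of all of them — the residual sum does not depend on the order) closes.  NOT CLAIMED: as in
`VolkovOnShellSetsOrder10C122`.
-/

-- One kernel certificate at a time: each chunk theorem below is sized for ONE kernel evaluation; sequential elaboration keeps the
-- process within the farm's memory cap (same device as the `MatrixMultiplication` certificate files).
set_option Elab.async false

namespace Summit.Ventures.QEDPrecision.Diagrams

set_option maxHeartbeats 4000000 in
set_option maxRecDepth 40000 in
/-- suffix: groups 4–8. -/
theorem closes131_s4 : blockResidual 5 rows131 s131_3 = sfx131 3 := by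
  rw [s131_3, blockResidual_append, closes131_s5]
  decide +kernel

set_option maxHeartbeats 4000000 in
set_option maxRecDepth 40000 in
/-- suffix: groups 3–8. -/
theorem closes131_s3 : blockResidual 5 rows131 s131_2 = sfx131 2 := by
  rw [s131_2, blockResidual_append, closes131_s4]
  decide +kernel

set_option maxHeartbeats 4000000 in
set_option maxRecDepth 40000 in
/-- suffix: groups 2–8. -/
theorem closes131_s2 : blockResidual 5 rows131 s131_1 = sfx131 1 := by
  rw [s131_1, blockResidual_append, closes131_s3]
  decide +kernel

set_option maxHeartbeats 4000000 in
set_option maxRecDepth 40000 in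
/-- suffix: groups 1–8. -/
theorem closes131_s1 : blockResidual 5 rows131 s131_0 = sfx131 0 := by
  rw [s131_0, blockResidual_append, closes131_s2]
  decide +kernel

set_option maxHeartbeats 4000000 in
set_option maxRecDepth 40000 in
/-- CLOSURE: the class (1;3,1) closes. -/
theorem class131_closes : closes 5 rows131 perm131 = true := by
  unfold closes perm131
  rw [closes131_s1]
  decide +kernel

end Summit.Ventures.QEDPrecision.Diagrams
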